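import Literature.NumberTheory.IwasawaTheory.ClassicalMuVanishesNonsplitCartanImageNoGrowth
import Literature.NumberTheory.EllipticCurves.FineSelmerClassGroupCriterionThm34Proofs
import Literature.NumberTheory.EllipticCurves.FineSelmerMuRoadCartanImageThree
import HarnessLib

set_option autoImplicit false

/-!
# Statement (A) at `p = 3` on the Cartan-normaliser rows from `μ(ℚ(P)) = 0`, modulo Ferrero–Washington ALONE
# (Coates–Sujatha Thm. 3.4 DISCHARGED; Iwasawa's growth theorem NOT needed)

Topic `NumberTheory/EllipticCurves`; THEOREM-ONLY file (no definition, no named fact, no `sorry`), written by the prover seat `bsd-potss-k8t-c4` g22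
(cell `bsd-potss`; supports the K9 / KT fine-Selmer residue cruxes stmt-BirchSwinnertonDyer-19942 / 19916 (asides 19386 / 19413) and the U₀ parents
19197 / 19982; closes nothing).  Twins of the three doors of `FineSelmerMuRoadCartanImageThree` (seat `bsd-potss-conjA-anchor` g11) with
* the binder `hCS : CoatesSujatha2005.thm34_…` DISCHARGED by `thm34_fineSelmerDual_moduleFinite_of_classicalMuVanishes_divisionField_holds`
  (`FineSelmerClassGroupCriterionThm34Proofs`, g22), and
* the binder `hI : iwasawa1959_classNumberPExp_growth` of the «`ℚ(P)` alone» non-split form REMOVED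
  (`classicalMuVanishes_divisionField_of_hasModPImageEqNonsplitCartanNormalizer_three''`, g22).
What remains displayed: Ferrero–Washington (`hFW`, for the abelian subfield of `ℚ(E[3])`) and the classical `μ = 0` input(s).

References: [CoatesSujatha2005] Thm. 3.4; [KuriharaPollack2007] §3.1; [Lemmermeyer1994] §1; [Washington1997] §7.5, §13.1, §13.3; [Serre1972] §2.2.
-/

noncomputable section

open scoped NumberField

open Field IntermediateField WeierstrassCurve Literature.NumberTheory.EllipticCurves Literature.NumberTheory.GaloisRepresentations
  Literature.NumberTheory.SerreUniformity Literature.NumberTheory.IwasawaTheory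

namespace Literature.NumberTheory.EllipticCurves.CoatesSujatha2005

/-- **Statement (A) at `3` for split-Cartan image, from `μ(ℚ(P)) = 0`, modulo Ferrero–Washington alone** (`hCS` discharged):
`HasSplitCartanNormalizerModPImage E 3`, `τ ∈ Γ_ℚ` an involution `≠ 1, −1` on `E[3]`, `μ = 0` for every cyclotomic `ℤ_3`-extension of the fixed
field of `τ|_{ℚ(E[3])}`; then the dual fine Selmer group over `ℚ_cyc` is finitely generated over `ℤ_3`.
[cite: CoatesSujatha2005, Thm. 3.4 (§3)] [cite: KuriharaPollack2007, §3.1] [cite: Lemmermeyer1994, §1 (Kuroda's class number formula)] -/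
theorem fineSelmerDual_moduleFinite_of_hasSplitCartanNormalizerModPImage_three_of_ferreroWashington
    (hFW : ferreroWashington1979_classicalMuVanishes) (W : WeierstrassCurve ℚ) [W.IsElliptic]
    (himg : HasSplitCartanNormalizerModPImage W 3) (τ : absoluteGaloisGroup ℚ)
    (hτ2 : ∀ T : W.geomTorsion (3 : ℕ), τ • (τ • T) = T) (hτ1 : ∃ T : W.geomTorsion (3 : ℕ), τ • T ≠ T)
    (hτm : ∃ T : W.geomTorsion (3 : ℕ), τ • T ≠ -T)
    (hμ : ∀ κE : ZpExtension ↥(fixedField (Subgroup.zpowers (absRestrictNormalHom (W.divisionField 3) τ))) 3,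
      κE.IsCyclotomic → ClassicalMuVanishes κE)
    (κ : ZpExtension ℚ 3) (hκ : κ.IsCyclotomic) :
    ∃ (γ : absoluteGaloisGroup ℚ) (D : W.FineSelmerDualData κ γ), Module.Finite ℤ_[3] (RestrictScalars ℤ_[3] (IwasawaAlgebra 3) D.X) :=
  fineSelmerDual_moduleFinite_of_hasSplitCartanNormalizerModPImage_three
    thm34_fineSelmerDual_moduleFinite_of_classicalMuVanishes_divisionField_holds hFW W himg τ hτ2 hτ1 hτm hμ κ hκ

/-- **Statement (A) at `3` for image equal to a non-split Cartan normaliser, from `μ(ℚ(P)) = 0` and `μ(ℚ(x P)) = 0`, modulo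
Ferrero–Washington alone** (`hCS` discharged). [cite: CoatesSujatha2005, Thm. 3.4 (§3)] [cite: KuriharaPollack2007, §3.1]
[cite: Lemmermeyer1994, §1 (Kuroda's class number formula)] -/
theorem fineSelmerDual_moduleFinite_of_hasModPImageEqNonsplitCartanNormalizer_three_of_ferreroWashington
    (hFW : ferreroWashington1979_classicalMuVanishes) (W : WeierstrassCurve ℚ) [W.IsElliptic]
    (himg : HasModPImageEqNonsplitCartanNormalizer W 3) (τ τm : absoluteGaloisGroup ℚ)
    (hτ2 : ∀ T : W.geomTorsion (3 : ℕ), τ • (τ • T) = T) (hτ1 : ∃ T : W.geomTorsion (3 : ℕ), τ • T ≠ T)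
    (hτm : ∃ T : W.geomTorsion (3 : ℕ), τ • T ≠ -T) (hm : ∀ T : W.geomTorsion (3 : ℕ), τm • T = -T)
    (hμ : ∀ κE : ZpExtension ↥(fixedField (Subgroup.zpowers (absRestrictNormalHom (W.divisionField 3) τ))) 3,
      κE.IsCyclotomic → ClassicalMuVanishes κE)
    (hμ' : ∀ κE : ZpExtension ↥(fixedField (Subgroup.zpowers (absRestrictNormalHom (W.divisionField 3) τ) ⊔
        Subgroup.zpowers (absRestrictNormalHom (W.divisionField 3) τm))) 3, κE.IsCyclotomic → ClassicalMuVanishes κE)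
    (κ : ZpExtension ℚ 3) (hκ : κ.IsCyclotomic) :
    ∃ (γ : absoluteGaloisGroup ℚ) (D : W.FineSelmerDualData κ γ), Module.Finite ℤ_[3] (RestrictScalars ℤ_[3] (IwasawaAlgebra 3) D.X) :=
  fineSelmerDual_moduleFinite_of_hasModPImageEqNonsplitCartanNormalizer_three
    thm34_fineSelmerDual_moduleFinite_of_classicalMuVanishes_divisionField_holds hFW W himg τ τm hτ2 hτ1 hτm hm hμ hμ' κ hκ

/-- **Statement (A) at `3` for image equal to a non-split Cartan normaliser, from `μ(ℚ(P)) = 0` ALONE, modulo Ferrero–Washington alone**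
(`hCS` discharged AND `hI` removed: twin of `fineSelmerDual_moduleFinite_of_hasModPImageEqNonsplitCartanNormalizer_three'`; the `ℚ(x P)` input is
derived without the growth theorem, `classicalMuVanishes_divisionField_of_hasModPImageEqNonsplitCartanNormalizer_three''`).
[cite: CoatesSujatha2005, Thm. 3.4 (§3)] [cite: KuriharaPollack2007, §3.1] [cite: Washington1997, §13.1, §13.3 Prop. 13.23] -/
theorem fineSelmerDual_moduleFinite_of_hasModPImageEqNonsplitCartanNormalizer_three_of_ferreroWashington'
    (hFW : ferreroWashington1979_classicalMuVanishes) (W : WeierstrassCurve ℚ) [W.IsElliptic]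
    (himg : HasModPImageEqNonsplitCartanNormalizer W 3) (τ : absoluteGaloisGroup ℚ)
    (hτ2 : ∀ T : W.geomTorsion (3 : ℕ), τ • (τ • T) = T) (hτ1 : ∃ T : W.geomTorsion (3 : ℕ), τ • T ≠ T)
    (hτm : ∃ T : W.geomTorsion (3 : ℕ), τ • T ≠ -T)
    (hμ : ∀ κE : ZpExtension ↥(fixedField (Subgroup.zpowers (absRestrictNormalHom (W.divisionField 3) τ))) 3,
      κE.IsCyclotomic → ClassicalMuVanishes κE)
    (κ : ZpExtension ℚ 3) (hκ : κ.IsCyclotomic) :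
    ∃ (γ : absoluteGaloisGroup ℚ) (D : W.FineSelmerDualData κ γ), Module.Finite ℤ_[3] (RestrictScalars ℤ_[3] (IwasawaAlgebra 3) D.X) :=
  thm34_fineSelmerDual_moduleFinite_of_classicalMuVanishes_divisionField_holds W 3 (by decide)
    (classicalMuVanishes_divisionField_of_hasModPImageEqNonsplitCartanNormalizer_three'' hFW W himg τ hτ2 hτ1 hτm hμ) κ hκ

end Literature.NumberTheory.EllipticCurves.CoatesSujatha2005

end
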